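import Summits.HodgeConjecture.HodgeConjecture.Theorems.F0P3cStCharTSRedOfEigenfunctional            -- ★ p852640 (this seat) «KEYS-RED ⟸ SECOND EIGENFUNCTIONAL★»: `exists_eigenfunctional_of_ne_bot_ne_top`, `toFun_one_apply_borel`, `eq_bot_of_forall_toFun_one_eq_zero`; brings ★ PS-UNITARY
import Summits.HodgeConjecture.HodgeConjecture.Theorems.F0P2pPrincipalSeriesUniqueSub                -- ★ (F0P2 lineage) `exists_coinvFunctional` (an eigenfunctional descends to the normalised Jacquet module)
import Summits.HodgeConjecture.HodgeConjecture.Theorems.F0P3cStCharTSJacLen1                        -- ★ N1 in the theorem world `n1_line_data` (`r_B i_G(χ)` = `wχ`-line + `χ`-quotient, dim 2; instance terms that unify in bounded time)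
import Summits.HodgeConjecture.HodgeConjecture.Theorems.F0P2nBorelCharactersUnipotent               -- ★ `rootDeltaChar_cmBorel_eq_one` (`δ_B^{1/2}|_N = 1`)
import Summits.HodgeConjecture.HodgeConjecture.Theorems.F0P3cStCharTSRedJH                          -- ★ (LH6-p04) `exists_ne_bot_ne_top_of_not_isIrreducible` (`i_G(χ) ≠ 0`)
import HarnessLib

/-!
# F0 · P3c · line LH6 «StCharTS» — «PS-IRRED-REGULAR★»: the unitary principal series `i_G(χ₁, χ₂)` of `U(Φ₃)(L⁺_v)` (`v` non-split) is IRREDUCIBLE off the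
# `w`-fixed locus — a reducible unitary `i_G(χ)` has `wχ = χ` (`χ̄₁⁻¹ = χ₁`) [Bruhat; Casselman1995 §6.6 Thm. 6.6.1 (Bruhat) pp. 65–66; §6.4 Prop. 6.4.1 p. 61; BernsteinZelevinsky1977 Thm. 2.9; Rogawski1990 §12.2 p. 173; Keys1984 §3]

Cell `pub/hodgecm-mathlib`, crux H413 = `stmt-HodgeConjecture-24833` (lane `--supports … --as helper`), route HCCMUnconditional; seat F0P2-p06 (g20), FILE 3 of the DEFAULT
«KEYS-RED ⟸ SECOND EIGENFUNCTIONAL★» (desk F0P3-plan (g18) WORD 19:37:24Z — FILE 1 ★ p852640, FILE 2 ★-filed p852668).  THEOREMS ONLY; ★-only imports.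

WHAT.  In RUNG 0's PAIR currency (★ `cmTorusCharPair`, `wχ` = ★ `cmWeylTorusCharPair = (χ̄₁⁻¹, χ₂)`), `G = U(Φ₃)(L⁺_v)`, `v` NON-SPLIT, `χ₁, χ₂` continuous with `|χ₁| = 1`:
* §1 (linear algebra) `exists_eq_smul_of_forall_mem_eq_zero`: on a 2-dimensional space two functionals killing the same line are proportional.
* §2 (generic, any parabolic triple `t = (P, M, N)` with `δ_P^{1/2}|_N = 1`, any representation `I` whose `N`-coinvariants are 2-dimensional with a line on which `M` acts
  (normalised) by `wχ`, `χ m₀ ≠ wχ m₀`): **`eigenfunctional_eq_smul_of_ne`** — any two `(P, χ δ_P^{1/2})`-eigenfunctionals on `I` are proportional (they descend to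
  `χ`-eigenfunctionals of `r_P(I)` (★ `exists_coinvFunctional`), vanish on the `wχ`-line, hence factor through the 1-dimensional quotient).  This is
  «`dim Hom_M(r_P I, χ) ≤ 1` off the `w`-fixed locus» [Casselman1995 Thm. 6.6.1; BernsteinZelevinsky1977 Thm. 2.9].
* §3 (CM head) **`cmWeylTorusCharPair_eq_of_ne_bot_ne_top`**: if `i_G(χ₁, χ₂)` has a `G`-stable `⊥ ≠ N ≠ ⊤` then `wχ = χ` — by ★ PS-UNITARY (complete reducibility for
  `|χ| = 1`), ★ FILE 1 §3 (a second eigenfunctional NOT proportional to `ev₁`), ★ N1 (the Jacquet data) and §2 (proportionality off the `w`-fixed locus) — and its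
  contrapositive **`isIrreducible_cmPrincipalSeries_of_cmWeylTorusCharPair_ne`** («Bruhat»: `wχ ≠ χ ⇒ i_G(χ)` irreducible, for unitary continuous `χ`).
  For RUNG 0's Keys list `hKeysRed` (★ `F0P3cStCharTSRung0Eight` :131, applied to UNITARY parameters) this is the in-house «regular» half: a reducible unitary `i_G(χ₁, χ₂)`
  has `χ₁|_{N E_v^×} = 1`; what stays PRINT there is the analytic part (at `wχ = χ`: `χ₁ = 1` and `χ₁|_{F_v^×} = ω` are irreducible [Keys1984 §7]) and every
  non-unitary parameter.
HONEST LABEL: HC_CM is proved only modulo the 7 printed citations (2 remaining named inputs: hLiu418 = `stmt-HodgeConjecture-24832`, h413 = `stmt-HodgeConjecture-24833`)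
until rung 0 closes; count-neutral (no named input is re-lettered here; a classical theorem made available in house).

## References
* [Casselman1995] W. Casselman, *Introduction to the theory of admissible representations of p-adic reductive groups* (1995), §6.6 Thm. 6.6.1 (Bruhat) pp. 65–66; §6.4 Prop. 6.4.1 p. 61; §3.2 Thm. 3.2.4 (Frobenius reciprocity) p. 34.
* [BernsteinZelevinsky1977] I. N. Bernstein, A. V. Zelevinsky, Ann. Sci. ÉNS 10 (1977), §2.3, Thm. 2.9, Geometrical Lemma 2.12.
* [Rogawski1990] J. D. Rogawski, *Automorphic Representations of Unitary Groups in Three Variables*, Ann. of Math. Stud. 123 (1990), §12.1 p. 171; §12.2 p. 173 («`w(χ₁, χ₂) = (χ̄₁⁻¹, χ₂)`»).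
* [Keys1984] D. Keys, *Principal series representations of special unitary groups over local fields*, Compositio Math. 51 (1984), §3, §7.
-/

set_option autoImplicit false
-- the mandated namespace has the single-problem summit's repeated segment (`HodgeConjecture.HodgeConjecture`)
set_option linter.dupNamespace false

noncomputable section

open NumberField IsDedekindDomain
open scoped Matrix
open Literature.NumberTheory.Rogawski1990 Literature.NumberTheory.Automorphic Literature.NumberTheory.Automorphic.UnitaryGroup

namespace Summit.HodgeConjecture.HodgeConjecture.Cruxes.H413.F0P3cStCharTSPSIrredRegular

/-! ## §1 Linear algebra: two functionals on a plane killing the same line are proportional -/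

/-- **Two linear functionals on a 2-dimensional space that vanish on the same line are proportional** (`φ₁ ≠ 0 ⇒ φ₂ = c • φ₁`): both factor through the
1-dimensional quotient. [folklore] -/
theorem exists_eq_smul_of_forall_mem_eq_zero {V : Type*} [AddCommGroup V] [Module ℂ V] [FiniteDimensional ℂ V]
    (hV : Module.finrank ℂ V = 2) (lin : Submodule ℂ V) (hlin : Module.finrank ℂ ↥lin = 1)
    (φ₁ φ₂ : V →ₗ[ℂ] ℂ) (h₁ : ∀ x ∈ lin, φ₁ x = 0) (h₂ : ∀ x ∈ lin, φ₂ x = 0) (hφ₁ : φ₁ ≠ 0) :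
    ∃ c : ℂ, φ₂ = c • φ₁ := by
  have hq : Module.finrank ℂ (V ⧸ lin) = 1 := by
    have h := lin.finrank_quotient_add_finrank
    omega
  have hk₁ : lin ≤ LinearMap.ker φ₁ := fun x hx => LinearMap.mem_ker.2 (h₁ x hx)
  have hk₂ : lin ≤ LinearMap.ker φ₂ := fun x hx => LinearMap.mem_ker.2 (h₂ x hx)
  obtain ⟨q₀, hq₀, hspan⟩ := finrank_eq_one_iff'.1 hq
  -- `ψᵢ := liftQ φᵢ`; `ψ₁ q₀ ≠ 0`
  have hψ₁ : lin.liftQ φ₁ hk₁ q₀ ≠ 0 := by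
    intro h0
    apply hφ₁
    ext x
    obtain ⟨a, ha⟩ := hspan (lin.mkQ x)
    have hx : φ₁ x = lin.liftQ φ₁ hk₁ (lin.mkQ x) := rfl
    rw [LinearMap.zero_apply, hx, ← ha, map_smul, h0, smul_zero]
  refine ⟨lin.liftQ φ₂ hk₂ q₀ * (lin.liftQ φ₁ hk₁ q₀)⁻¹, ?_⟩
  ext x
  obtain ⟨a, ha⟩ := hspan (lin.mkQ x)
  have hx₁ : φ₁ x = lin.liftQ φ₁ hk₁ (lin.mkQ x) := rfl
  have hx₂ : φ₂ x = lin.liftQ φ₂ hk₂ (lin.mkQ x) := rfl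
  rw [LinearMap.smul_apply, hx₁, hx₂, ← ha, map_smul, map_smul, smul_eq_mul, smul_eq_mul, smul_eq_mul]
  field_simp

/-! ## §2 Generic: off the `w`-fixed locus, `(P, χ δ_P^{1/2})`-eigenfunctionals are unique up to scalar -/

section Generic

variable {G : Type*} [Group G] [TopologicalSpace G] [IsTopologicalGroup G] (t : ParabolicTriple G) [LocallyCompactSpace t.P]

/-- **`dim Hom_M(r_P I, χ) ≤ 1` off the `w`-fixed locus, in eigenfunctional form.**  Let `t = (P, M, N)` with `δ_P^{1/2}|_N = 1`, `I` a representation whose `N`-coinvariants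
are 2-dimensional with a line `lin` on which `M` acts (normalised, ★ `normalizedJacquet`) by `wχ`, and `χ m₀ ≠ wχ m₀`.  Then any two linear functionals `ℓ₁, ℓ₂` with
`ℓᵢ (I(p) v) = χ(proj p) δ_P^{1/2}(p) ℓᵢ v` (`p ∈ P`), `ℓ₁ ≠ 0`, are proportional: they descend to `χ`-eigenfunctionals `ℓ̄ᵢ` of `r_P(I)` (★ `exists_coinvFunctional`), which vanish on
the `wχ`-line (`(wχ m₀ − χ m₀) ℓ̄ᵢ x = 0`) and so factor through the 1-dimensional quotient (§1).  [cite: Casselman1995, §6.6 Thm. 6.6.1 p. 65; §3.2 Thm. 3.2.4 (Frobenius) p. 34] [cite: BernsteinZelevinsky1977, §2.3, Thm. 2.9] -/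
theorem eigenfunctional_eq_smul_of_ne (hδ : ∀ (n : G) (hn : n ∈ t.N), rootDeltaChar t.P ⟨n, t.N_le hn⟩ = 1)
    {V : Type*} [AddCommGroup V] [Module ℂ V] (I : Representation ℂ G V) (χ wχ : t.M →* ℂˣ) (m₀ : t.M) (hm₀ : χ m₀ ≠ wχ m₀)
    [FiniteDimensional ℂ (t.restrict I).Coinvariants] (hdim : Module.finrank ℂ (t.restrict I).Coinvariants = 2)
    (lin : Submodule ℂ (t.restrict I).Coinvariants) (hlin1 : Module.finrank ℂ ↥lin = 1)
    (hlinw : ∀ (m : t.M), ∀ x ∈ lin, I.normalizedJacquet t m x = ((wχ m : ℂˣ) : ℂ) • x)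
    (ℓ₁ ℓ₂ : V →ₗ[ℂ] ℂ)
    (hℓ₁ : ∀ (p : t.P) (v : V), ℓ₁ (I p v) = ((χ (t.proj p) : ℂˣ) : ℂ) * ((rootDeltaChar t.P p : ℂˣ) : ℂ) * ℓ₁ v)
    (hℓ₂ : ∀ (p : t.P) (v : V), ℓ₂ (I p v) = ((χ (t.proj p) : ℂˣ) : ℂ) * ((rootDeltaChar t.P p : ℂˣ) : ℂ) * ℓ₂ v)
    (hℓ₁0 : ℓ₁ ≠ 0) : ∃ c : ℂ, ℓ₂ = c • ℓ₁ := by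
  obtain ⟨lb₁, hmk₁, heq₁⟩ := F0P2pPrincipalSeriesUniqueSub.exists_coinvFunctional t hδ χ I ℓ₁ hℓ₁
  obtain ⟨lb₂, hmk₂, heq₂⟩ := F0P2pPrincipalSeriesUniqueSub.exists_coinvFunctional t hδ χ I ℓ₂ hℓ₂
  -- both descended functionals vanish on the `wχ`-line
  have hne : ((wχ m₀ : ℂˣ) : ℂ) - ((χ m₀ : ℂˣ) : ℂ) ≠ 0 := sub_ne_zero.2 fun h => hm₀ (Units.val_injective h.symm)
  have hvan : ∀ (lb : (t.restrict I).Coinvariants →ₗ[ℂ] ℂ),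
      (∀ (m : t.M) (x : (t.restrict I).Coinvariants), lb (I.normalizedJacquet t m x) = ((χ m : ℂˣ) : ℂ) * lb x) →
      ∀ x ∈ lin, lb x = 0 := by
    intro lb heq x hx
    have h := heq m₀ x
    rw [hlinw m₀ x hx, map_smul, smul_eq_mul] at h
    have h' : (((wχ m₀ : ℂˣ) : ℂ) - ((χ m₀ : ℂˣ) : ℂ)) * lb x = 0 := by rw [sub_mul, h, sub_self]
    exact (mul_eq_zero.1 h').resolve_left hne
  have hlb₁0 : lb₁ ≠ 0 := by
    intro h0
    apply hℓ₁0
    ext v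
    rw [← hmk₁ v, h0, LinearMap.zero_apply, LinearMap.zero_apply]
  obtain ⟨c, hc⟩ := exists_eq_smul_of_forall_mem_eq_zero hdim lin hlin1 lb₁ lb₂ (hvan lb₁ heq₁) (hvan lb₂ heq₂) hlb₁0
  refine ⟨c, ?_⟩
  ext v
  rw [← hmk₂ v, hc, LinearMap.smul_apply, LinearMap.smul_apply, hmk₁ v]

end Generic

/-! ## §3 The CM head: `U(Φ₃)(L⁺_v)`, `v` non-split, unitary continuous `(χ₁, χ₂)` -/

section CM

variable (L : Type) [Field L] [NumberField L] [IsCMField L] (v : HeightOneSpectrum (𝓞 ↥(maximalRealSubfield L)))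
  (hns : ∀ w : PlacesOver L v, IsCMField.complexConj L • w.1 = w.1)

include hns in
/-- **`|χ| = 1` for `χ = (χ₁, χ₂)` with `|χ₁| = 1`** (`χ₂` lives on the compact `E¹_v`, `v` non-split: ★ `norm_apply_normOneUnits_eq_one`). [cite: Rogawski1990, §12.1 p. 171] -/
theorem norm_cmTorusCharPair_eq_one_of_norm_eq_one (χ₁ : (LocalRing L v)ˣ →* ℂˣ) (χ₂ : ↥(normOneUnits (conjLocal L (IsCMField.complexConj L) v)) →* ℂˣ)
    (h2 : Continuous fun x => ((χ₂ x : ℂˣ) : ℂ)) (hχ₁u : ∀ x, ‖((χ₁ x : ℂˣ) : ℂ)‖ = 1)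
    (t : ↥(torusU (conjLocal L (IsCMField.complexConj L) v) (cmLocalForm L 3 v))) :
    ‖((cmTorusCharPair L v χ₁ χ₂ t : ℂˣ) : ℂ)‖ = 1 := by
  rw [cmTorusCharPair, torusCharPair_apply, Units.val_mul, norm_mul, hχ₁u,
    F0P3cStCharTSPrincipalSeriesUnitary.norm_apply_normOneUnits_eq_one L v hns χ₂ h2, one_mul]

include hns in
set_option synthInstance.maxHeartbeats 400000 in
set_option maxHeartbeats 8000000 in
-- statement∕proof-heavy: the `SmoothInd` carrier of `cmPrincipalSeries`, its Jacquet module from ★ N1 (class of ★ LdsRedTwoOfReducible §2)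
/-- **A REDUCIBLE unitary `i_G(χ₁, χ₂)` is `w`-FIXED: `wχ = χ`, i.e. `χ̄₁⁻¹ = χ₁`** (`v` non-split, `χ₁, χ₂` continuous, `|χ₁| = 1`).  If `i_G(χ₁, χ₂)` has a `G`-stable `⊥ ≠ N ≠ ⊤`:
it is completely reducible (★ PS-UNITARY), so (★ FILE 1 `exists_eigenfunctional_of_ne_bot_ne_top`) it carries a `(B, χ δ_B^{1/2})`-eigenfunctional `ℓ` NOT proportional to
`ev₁` — itself a non-zero eigenfunctional (★ `toFun_one_apply_borel`; `ev₁ = 0` would force `⊤ = ⊥`).  Were `wχ ≠ χ`, §2 over the ★ N1 Jacquet data (`r_B i_G(χ)` =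
`wχ`-line + `χ`-quotient) would make `ℓ` and `ev₁` proportional.  [cite: Casselman1995, §6.6 Thm. 6.6.1 (Bruhat) pp. 65–66; §6.4 Prop. 6.4.1 p. 61] [cite: BernsteinZelevinsky1977, Thm. 2.9] [cite: Rogawski1990, §12.2 p. 173] -/
theorem cmWeylTorusCharPair_eq_of_ne_bot_ne_top
    (χ₁ : (LocalRing L v)ˣ →* ℂˣ) (χ₂ : ↥(normOneUnits (conjLocal L (IsCMField.complexConj L) v)) →* ℂˣ)
    (h1 : Continuous fun x => ((χ₁ x : ℂˣ) : ℂ)) (h2 : Continuous fun x => ((χ₂ x : ℂˣ) : ℂ)) (hχ₁u : ∀ x, ‖((χ₁ x : ℂˣ) : ℂ)‖ = 1)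
    (hred : ∃ N : Subrepresentation (cmPrincipalSeries L 3 v (cmTorusCharPair L v χ₁ χ₂)), N ≠ ⊥ ∧ N ≠ ⊤) :
    cmWeylTorusCharPair L v χ₁ χ₂ = cmTorusCharPair L v χ₁ χ₂ := by
  haveI := locallyCompactSpace_cmBorelU L 3 v
  by_contra hw
  obtain ⟨m₀, hm₀⟩ : ∃ m₀, cmTorusCharPair L v χ₁ χ₂ m₀ ≠ cmWeylTorusCharPair L v χ₁ χ₂ m₀ := by
    by_contra h
    push Not at h
    exact hw (MonoidHom.ext fun m => (h m).symm)
  obtain ⟨N', hb, ht⟩ := hred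
  -- complete reducibility and the second eigenfunctional (★ PS-UNITARY, ★ FILE 1 §3)
  have hss := F0P3cStCharTSPrincipalSeriesUnitary.isSemisimpleRepresentation_cmPrincipalSeries L 3 v (cmTorusCharPair L v χ₁ χ₂)
    (norm_cmTorusCharPair_eq_one_of_norm_eq_one L v hns χ₁ χ₂ h2 hχ₁u)
  obtain ⟨ℓ, hℓ, hind⟩ := F0P3cStCharTSRedOfEigenfunctional.exists_eigenfunctional_of_ne_bot_ne_top L 3 v (cmTorusCharPair L v χ₁ χ₂) hss N' hb ht
  -- `ev₁` as an opaque eigenfunctional, non-zero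
  obtain ⟨ev, hev⟩ : ∃ ev : Representation.SmoothInd (cmBorelTriple L 3 v).P
        (Representation.twist (((Representation.trivial ℂ ↥(torusU (conjLocal L (IsCMField.complexConj L) v) (cmLocalForm L 3 v)) ℂ).twist
          (cmTorusCharPair L v χ₁ χ₂)).comp (cmBorelTriple L 3 v).proj) (rootDeltaChar (cmBorelTriple L 3 v).P)) →ₗ[ℂ] ℂ, ∀ f, ev f = f.toFun 1 :=
    ⟨{ toFun := fun f => f.toFun 1
       map_add' := fun f g => by rw [Representation.SmoothInd.toFun_add]; rfl
       map_smul' := fun c f => by rw [Representation.SmoothInd.toFun_smul]; rfl }, fun f => rfl⟩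
  have hevB : ∀ (p : ↥(cmBorelTriple L 3 v).P) (f : _), ev (cmPrincipalSeries L 3 v (cmTorusCharPair L v χ₁ χ₂) p.1 f) =
      ((cmTorusCharPair L v χ₁ χ₂ ((cmBorelTriple L 3 v).proj p) : ℂˣ) : ℂ) * ((rootDeltaChar (cmBorelTriple L 3 v).P p : ℂˣ) : ℂ) * ev f := by
    intro p f
    have e := F0P3cStCharTSRedOfEigenfunctional.toFun_one_apply_borel L 3 v (cmTorusCharPair L v χ₁ χ₂) p f
    simp only [hev]
    exact e
  have hev0 : ev ≠ 0 := by
    intro h0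
    have htop : (⊤ : Subrepresentation (cmPrincipalSeries L 3 v (cmTorusCharPair L v χ₁ χ₂))) = ⊥ :=
      F0P3cStCharTSRedOfEigenfunctional.eq_bot_of_forall_toFun_one_eq_zero L 3 v (cmTorusCharPair L v χ₁ χ₂) ⊤ fun f _ => by
        rw [← hev f, h0, LinearMap.zero_apply]
    exact hb (le_bot_iff.1 (htop ▸ le_top))
  -- the ★ N1 Jacquet data, unpacked once; proportionality off the `w`-fixed locus (§2)
  obtain ⟨hfin, hdim, lin, hlin1, hlinw, -⟩ := F0P3cStCharTSJacLen1.n1_line_data L v hns χ₁ χ₂ h1 h2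
  haveI := hfin
  obtain ⟨c, hc⟩ := eigenfunctional_eq_smul_of_ne (cmBorelTriple L 3 v) (F0P2nBorelCharactersUnipotent.rootDeltaChar_cmBorel_eq_one L v)
    (cmPrincipalSeries L 3 v (cmTorusCharPair L v χ₁ χ₂)) (cmTorusCharPair L v χ₁ χ₂) (cmWeylTorusCharPair L v χ₁ χ₂) m₀ hm₀ hdim lin hlin1 hlinw
    ev ℓ hevB hℓ hev0
  obtain ⟨f, hf⟩ := hind c
  exact hf (by rw [hc, LinearMap.smul_apply, hev, smul_eq_mul])

include hns in
set_option synthInstance.maxHeartbeats 400000 in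
set_option maxHeartbeats 8000000 in
-- statement∕proof-heavy: the `SmoothInd` carrier of `cmPrincipalSeries` (class of ★ RedJH §1)
/-- **«PS-IRRED-REGULAR★» (Bruhat irreducibility for `U(Φ₃)(L⁺_v)`).**  At a non-split `v`, for continuous `χ₁, χ₂` with `|χ₁| = 1` and `wχ ≠ χ` (`χ̄₁⁻¹ ≠ χ₁`, i.e. `χ₁` non-trivial
on the norms `N E_v^×`), the unitary principal series `i_G(χ₁, χ₂)` = ★ `cmPrincipalSeries L 3 v (cmTorusCharPair L v χ₁ χ₂)` is IRREDUCIBLE.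
[cite: Casselman1995, §6.6 Thm. 6.6.1 (Bruhat) pp. 65–66; §6.4 Prop. 6.4.1 p. 61] [cite: BernsteinZelevinsky1977, Thm. 2.9] [cite: Rogawski1990, §12.2 p. 173] [cite: Keys1984, §3] -/
theorem isIrreducible_cmPrincipalSeries_of_cmWeylTorusCharPair_ne
    (χ₁ : (LocalRing L v)ˣ →* ℂˣ) (χ₂ : ↥(normOneUnits (conjLocal L (IsCMField.complexConj L) v)) →* ℂˣ)
    (h1 : Continuous fun x => ((χ₁ x : ℂˣ) : ℂ)) (h2 : Continuous fun x => ((χ₂ x : ℂˣ) : ℂ)) (hχ₁u : ∀ x, ‖((χ₁ x : ℂˣ) : ℂ)‖ = 1)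
    (hw : cmWeylTorusCharPair L v χ₁ χ₂ ≠ cmTorusCharPair L v χ₁ χ₂) :
    (cmPrincipalSeries L 3 v (cmTorusCharPair L v χ₁ χ₂)).IsIrreducible := by
  by_contra hirr
  exact hw (cmWeylTorusCharPair_eq_of_ne_bot_ne_top L v hns χ₁ χ₂ h1 h2 hχ₁u
    (F0P3cStCharTSRedJH.exists_ne_bot_ne_top_of_not_isIrreducible L v χ₁ χ₂ h1 h2 hirr))

end CM

end Summit.HodgeConjecture.HodgeConjecture.Cruxes.H413.F0P3cStCharTSPSIrredRegular

end
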